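/-
Copyright (c) 2026 The HCML crux team. All rights reserved.
Released under Apache 2.0 license as described in the file LICENSE.
Authors: K2E5-p17 (g4) (explicit-unit `hodgecm-mathlib-K2E5-p17-g4`)
-/
import Summits.HodgeConjecture.HodgeConjecture.Theorems.K2E3GL3TruncatedCharMixedTorusRadius   -- ★ T18-mixed (K2E3-p14 (g5)): output `∃ t, tγ = γt ∧ 𝔅(x t)`, norm form, anisotropy
import Summits.HodgeConjecture.HodgeConjecture.Theorems.K2E3GL3CuspFormCancellation             -- ★ (C) (this seat): `A₃` memberships; brings ★ (B-val), ★ B4-0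
import HarnessLib

/-!
# K2_E3 road (h413), U12 «Characters» — T20-GL₃ GLUE at the mixed Cartan: the centraliser of `γ = diag(C_π, c)` lies in `𝔅_{L_d} · A₃`
# (`A₃ = {diag(λ,λ,μ)}`, `|ϖ^{L_d}| ≤ |disc π|`), hence T18-mixed's `𝔅_M(x t)`, `tγ = γt` gives the support `x ∈ 𝔅_{M + L_d} · A₃` of ★ `cuspForm_cancellation_GL3_blockScalar`

Cell `pub/hodgecm-mathlib` (D-0151), Track B, seat K2E5-p17 (g4); line lead K2E3-p23 (g5) ((M12-5) the companion normal form `γ = leviBlock(C_π, c)`,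
`C_π = !![0, −N; 1, T]`), co-owner K2E3-p21 (g5) ((C-shell B) slice packaging), T18-mixed owner K2E3-p14 (g5), dealer K2E3-plan (g3).
`--supports stmt-HodgeConjecture-24833 --as helper`; THEOREMS ONLY (no definition ∕ instance ∕ notation ∕ named fact ∕ `sorry`); never imports `Cruxes/…/Lines`.  COUNT-NEUTRAL.

THE MATHEMATICS [HarishChandra1970, Part VII §2 Theorem 18 p. 69 and §3 p. 71 (ii): for the torus `Γ = T_E = E^× × F^×`, `Γ = A_Γ · Γ_c` with `A_Γ = {diag(λ,λ,μ)}` its split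
component and `Γ_c ⊆ Ω_{const}` of bounded height].  Let `γ = !![0, −N, 0; 1, T, 0; 0, 0, c]` with `π = X² − TX + N` having no root in `F`, `|T| ≤ 1`, `|N| ≤ 1` and `π(c) ≠ 0`.
* §1 `coe_eq_blockT_of_comm`: `tγ = γt ⇒ t = !![a, −bN, 0; b, a + bT, 0; 0, 0, z]` (`a = t₀₀`, `b = t₁₀`, `z = t₂₂`; the off-block entries die by `π(c) ≠ 0`, the block is
  `a + b C_π` since `N ≠ 0`).
* §2 **`exists_blockScalar_mul_adBall_of_comm`**: such a `t` is `a₃ · k` with `a₃ = diag(λ, λ, z)` (`λ ∈ {a, b}` of maximal `|·|`) and `k ∈ 𝔅_{L_d}` whenever `|ϖ^{L_d}| ≤ |T² − 4N|`: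
  `k = diag((a + bC_π)∕λ, 1)` has integral entries, `det k = u² + uvT + v²N` with `max(|u|,|v|) = 1`, so `|det k| ≥ |T² − 4N|` by the ANISOTROPY bound ★ p14
  `v_discr_mul_sq_le_v_normForm` (Hensel), and `k⁻¹ = adj(k)∕det k`.
* §3 **`mem_adBall_mul_A₃_of_comm`** (`𝔅_M(x t)`, `tγ = γt` ⇒ `x = (x t k⁻¹) · a₃⁻¹ ∈ 𝔅_{M + L_d} · A₃`, `A₃ = M_{id} ⊓ C(M_{(2,1)})` via ★ (C) `mem_centralizer_of_coe_eq_diagonal`)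
  and **`mem_adBall_mul_A₃_of_conj_integral_mixed`** = ★ T18-mixed `exists_adBall_mul_centralizer_of_conj_integral_mixed_normalised` ∘ §3: the `hsupp` of ★
  `cuspForm_cancellation_GL3_blockScalar` for the slices `x ↦ θ(x γ x⁻¹)` at the mixed Cartan, with `m_C = 6s + L + L_d` explicit.

HONEST LABEL: HC_CM is proved only modulo the 7 printed citations (2 remaining named inputs: hLiu418 = stmt-HodgeConjecture-24832, h413 = stmt-HodgeConjecture-24833)
until rung 0 closes; count-neutral helper (linear algebra of the mixed torus; nothing printed is asserted).

## References
* [HarishChandra1970] Harish-Chandra (notes by G. van Dijk), *Harmonic Analysis on Reductive p-adic Groups*, LNM 162 (1970), Part VII §2 Thm. 18 p. 69, §3 p. 71 (ii), Lemma 46 p. 73.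
* [NeukirchANT1999] J. Neukirch, *Algebraic Number Theory* (1999), Ch. II §4 (4.6) (Hensel), §5 (norm forms of quadratic extensions).
-/

set_option autoImplicit false
set_option linter.dupNamespace false   -- `Summit.HodgeConjecture.HodgeConjecture.…` (D-0017 nested layout; lakefile exemption for Summits)

noncomputable section

open scoped MatrixGroups WithZero Pointwise
open Matrix ValuativeRel
open Literature.NumberTheory.Automorphic
open Summit.HodgeConjecture.HodgeConjecture.Cruxes.H413.K2E3GLnAdHeightBalls
open Summit.HodgeConjecture.HodgeConjecture.Cruxes.H413.K2E3GLnCuspFormCancellationInputs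
open Summit.HodgeConjecture.HodgeConjecture.Cruxes.H413.K2E3GL3MixedTorusNormForm
open Summit.HodgeConjecture.HodgeConjecture.Cruxes.H413.K2E3GL3TruncatedCharMixedTorusRadius
open Summit.HodgeConjecture.HodgeConjecture.Cruxes.H413.K2E3GL3CuspFormCancellation

namespace Summit.HodgeConjecture.HodgeConjecture.Cruxes.H413.K2E3GL3MixedCentralizerSupport

/-! ## §1 The centraliser of `γ = diag(C_π, c)` -/

section Shape

variable {F : Type*} [Field F]

/-- **THE CENTRALISER OF `γ = diag(C_π, c)`**: if `tγ = γt` (`π(c) ≠ 0`, `N ≠ 0`) then `t = !![a, −bN, 0; b, a + bT, 0; 0, 0, z]` with `a = t₀₀`, `b = t₁₀`, `z = t₂₂` — i.e.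
`t = diag(a + bC_π, z) ∈ E^× × F^×`. [cite: HarishChandra1970, Part VII §2 Theorem 18 p. 69] -/
theorem coe_eq_blockT_of_comm {t γ : GL (Fin 3) F} {T N c : F} (hγ : (γ : Matrix (Fin 3) (Fin 3) F) = !![0, -N, 0; 1, T, 0; 0, 0, c])
    (hπc : c ^ 2 - T * c + N ≠ 0) (hN0 : N ≠ 0) (ht : t * γ = γ * t) :
    (t : Matrix (Fin 3) (Fin 3) F) = !![(t : Matrix (Fin 3) (Fin 3) F) 0 0, -((t : Matrix (Fin 3) (Fin 3) F) 1 0 * N), 0;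
      (t : Matrix (Fin 3) (Fin 3) F) 1 0, (t : Matrix (Fin 3) (Fin 3) F) 0 0 + (t : Matrix (Fin 3) (Fin 3) F) 1 0 * T, 0;
      0, 0, (t : Matrix (Fin 3) (Fin 3) F) 2 2] := by
  set X : Matrix (Fin 3) (Fin 3) F := (t : Matrix (Fin 3) (Fin 3) F) with hX
  have hm : X * !![0, -N, 0; 1, T, 0; 0, 0, c] = !![0, -N, 0; 1, T, 0; 0, 0, c] * X := by
    rw [hX, ← hγ, ← Units.val_mul, ht, Units.val_mul]
  have e : ∀ i j, (X * !![0, -N, 0; 1, T, 0; 0, 0, c]) i j = (!![0, -N, 0; 1, T, 0; 0, 0, c] * X) i j := fun i j => by rw [hm]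
  have e20 := e 2 0; have e21 := e 2 1; have e02 := e 0 2; have e12 := e 1 2; have e00 := e 0 0; have e01 := e 0 1
  simp [Matrix.mul_apply, Fin.sum_univ_three] at e20 e21 e02 e12 e00 e01
  -- the off-block entries
  have h20 : X 2 0 = 0 := by
    have h : (c ^ 2 - T * c + N) * X 2 0 = 0 := by linear_combination (T - c) * e20 - e21
    rcases mul_eq_zero.1 h with h | h
    · exact absurd h hπc
    · exact h
  have h21 : X 2 1 = 0 := by rw [e20, h20, mul_zero]
  have h12 : X 1 2 = 0 := by
    have h : (c ^ 2 - T * c + N) * X 1 2 = 0 := by linear_combination e02 + c * e12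
    rcases mul_eq_zero.1 h with h | h
    · exact absurd h hπc
    · exact h
  have h02 : X 0 2 = 0 := by linear_combination -e12 + (c - T) * h12
  -- the block is `a + b C_π`
  have h01 : X 0 1 = -(X 1 0 * N) := by linear_combination e00
  have h11 : X 1 1 = X 0 0 + X 1 0 * T := by
    have h : N * (X 1 1 - X 0 0 - X 1 0 * T) = 0 := by linear_combination e01 - T * e00
    rcases mul_eq_zero.1 h with h | h
    · exact absurd h hN0
    · linear_combination h
  ext i j
  fin_cases i <;> fin_cases j <;> simp [h20, h21, h12, h02, h01, h11]

/-- The determinant of the centraliser element: `det t = (a² + abT + b²N) · z`. [folklore] -/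
theorem det_blockT_mul (T N a b z : F) : (!![a, -(b * N), 0; b, a + b * T, 0; 0, 0, z] : Matrix (Fin 3) (Fin 3) F).det = (a ^ 2 + a * b * T + b ^ 2 * N) * z := by
  rw [Matrix.det_fin_three]
  simp
  ring

end Shape

/-! ## §2 The factorisation `t = a₃ · k`, `a₃ = diag(λ, λ, z)`, `k ∈ 𝔅_{L_d}` -/

section Factor

variable {F : Type*} [Field F] [Valued F ℤᵐ⁰] [ValuativeRel F] [(Valued.v : Valuation F ℤᵐ⁰).Compatible] [IsNonarchimedeanLocalField F]

omit [IsNonarchimedeanLocalField F] in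
/-- Adjugate entries of a matrix with integral entries are integral (★ `valBound_one_adjugate` through the bridge). [folklore] -/
theorem v_adjugate_apply_le_one {n : ℕ} {M : Matrix (Fin n) (Fin n) F} (hM : ∀ i j, Valued.v (M i j) ≤ 1) (i j : Fin n) :
    Valued.v (M.adjugate i j) ≤ 1 :=
  (v_le_one_iff_valuation_le_one _).2 (valBound_one_adjugate (fun i j => (v_le_one_iff_valuation_le_one _).1 (hM i j)) i j)

/-- **THE SPLIT COMPONENT TIMES A BOUNDED PART**: for `γ = diag(C_π, c)` (`π = X² − TX + N` without roots in `F`, `|T|, |N| ≤ 1`, `π(c) ≠ 0`) and `|ϖ^{L_d}| ≤ |T² − 4N|`,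
every `t` with `tγ = γt` factors as `t = a₃ · k` with `a₃ = diag(λ, λ, z)` and `k ∈ 𝔅_{L_d}` — print's `Γ = A_Γ Γ_c` for the torus `E^× × F^×`, with the height of the
compact part `Γ_c` controlled by the discriminant (anisotropy ★ `v_discr_mul_sq_le_v_normForm`). [cite: HarishChandra1970, Part VII §3 p. 71 (ii), Lemma 46 p. 73]
[cite: NeukirchANT1999, Ch. II §4 (4.6)] -/
theorem exists_blockScalar_mul_adBall_of_comm {ϖ : F} {t γ : GL (Fin 3) F} {T N c : F} (hγ : (γ : Matrix (Fin 3) (Fin 3) F) = !![0, -N, 0; 1, T, 0; 0, 0, c])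
    (hπ : ∀ r : F, r ^ 2 - T * r + N ≠ 0) (hT : Valued.v T ≤ 1) (hN : Valued.v N ≤ 1) (hπc : c ^ 2 - T * c + N ≠ 0)
    {Ld : ℕ} (hdisc : Valued.v (ϖ ^ Ld) ≤ Valued.v (T ^ 2 - 4 * N)) (ht : t * γ = γ * t) :
    ∃ a₃ k : GL (Fin 3) F, t = a₃ * k ∧ (∃ lam z : F, (a₃ : Matrix (Fin 3) (Fin 3) F) = Matrix.diagonal ![lam, lam, z]) ∧
      ∀ i j k' l, Valued.v (ϖ ^ Ld * ((k : Matrix (Fin 3) (Fin 3) F) i j * ((k⁻¹ : GL (Fin 3) F) : Matrix (Fin 3) (Fin 3) F) k' l)) ≤ 1 := by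
  have hN0 : N ≠ 0 := by intro h; apply hπ 0; rw [h]; ring
  set a : F := (t : Matrix (Fin 3) (Fin 3) F) 0 0 with ha
  set b : F := (t : Matrix (Fin 3) (Fin 3) F) 1 0 with hb
  set z : F := (t : Matrix (Fin 3) (Fin 3) F) 2 2 with hz
  have hshape : (t : Matrix (Fin 3) (Fin 3) F) = !![a, -(b * N), 0; b, a + b * T, 0; 0, 0, z] := coe_eq_blockT_of_comm hγ hπc hN0 ht
  -- `det t = Q₀ z ≠ 0`
  have hdet : (a ^ 2 + a * b * T + b ^ 2 * N) * z ≠ 0 := by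
    rw [← det_blockT_mul, ← hshape]
    exact (Matrix.isUnits_det_units t).ne_zero
  have hz0 : z ≠ 0 := fun h => hdet (by rw [h, mul_zero])
  have hQ0 : a ^ 2 + a * b * T + b ^ 2 * N ≠ 0 := fun h => hdet (by rw [h, zero_mul])
  -- choose `lam ∈ {a, b}` of maximal absolute value
  obtain ⟨lam, hlam0, hal, hbl, hone⟩ : ∃ lam : F, lam ≠ 0 ∧ Valued.v a ≤ Valued.v lam ∧ Valued.v b ≤ Valued.v lam ∧ (a = lam ∨ b = lam) := by
    by_cases hab : Valued.v b ≤ Valued.v a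
    · refine ⟨a, fun ha0 => ?_, le_rfl, hab, Or.inl rfl⟩
      rw [ha0, map_zero, le_zero_iff, map_eq_zero] at hab
      apply hQ0; rw [ha0, hab]; ring
    · refine ⟨b, fun hb0 => ?_, (not_le.1 hab).le, le_rfl, Or.inr rfl⟩
      rw [hb0, map_zero] at hab
      exact hab zero_le
  -- the split component and the bounded part
  set a₃ : GL (Fin 3) F := glDiagonal 3 F ![Units.mk0 lam hlam0, Units.mk0 lam hlam0, Units.mk0 z hz0] with ha₃
  have ha₃c : (a₃ : Matrix (Fin 3) (Fin 3) F) = Matrix.diagonal ![lam, lam, z] := by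
    rw [ha₃, coe_glDiagonal]
    congr 1
    funext i; fin_cases i <;> rfl
  set u : F := a * lam⁻¹ with hu
  set w : F := b * lam⁻¹ with hw
  have hu1 : Valued.v u ≤ 1 := by
    rw [hu, map_mul, map_inv₀]; exact mul_inv_le_one_of_le₀ hal zero_le
  have hw1 : Valued.v w ≤ 1 := by
    rw [hw, map_mul, map_inv₀]; exact mul_inv_le_one_of_le₀ hbl zero_le
  have hone' : u = 1 ∨ w = 1 := by
    rcases hone with h | h
    · exact Or.inl (by rw [hu, h, mul_inv_cancel₀ hlam0])
    · exact Or.inr (by rw [hw, h, mul_inv_cancel₀ hlam0])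
  set k : GL (Fin 3) F := a₃⁻¹ * t with hk
  have hkc : (k : Matrix (Fin 3) (Fin 3) F) = !![u, -(w * N), 0; w, u + w * T, 0; 0, 0, 1] := by
    rw [hk, Units.val_mul, coe_inv_eq_diagonal_inv ha₃c, hshape]
    ext i j
    rw [Matrix.diagonal_mul]
    fin_cases i <;> fin_cases j
    · show (![lam, lam, z] 0)⁻¹ * a = u
      rw [hu, mul_comm]; rfl
    · show (![lam, lam, z] 0)⁻¹ * -(b * N) = -(w * N)
      rw [hw]; show lam⁻¹ * -(b * N) = -(b * lam⁻¹ * N); ring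
    · show (![lam, lam, z] 0)⁻¹ * 0 = 0
      rw [mul_zero]
    · show (![lam, lam, z] 1)⁻¹ * b = w
      rw [hw, mul_comm]; rfl
    · show (![lam, lam, z] 1)⁻¹ * (a + b * T) = u + w * T
      rw [hu, hw]; show lam⁻¹ * (a + b * T) = a * lam⁻¹ + b * lam⁻¹ * T; ring
    · show (![lam, lam, z] 1)⁻¹ * 0 = 0
      rw [mul_zero]
    · show (![lam, lam, z] 2)⁻¹ * 0 = 0
      rw [mul_zero]
    · show (![lam, lam, z] 2)⁻¹ * 0 = 0
      rw [mul_zero]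
    · show (![lam, lam, z] 2)⁻¹ * z = 1
      show z⁻¹ * z = 1
      rw [inv_mul_cancel₀ hz0]
  -- entries of `k` are integral
  have hkint : ∀ i j, Valued.v ((k : Matrix (Fin 3) (Fin 3) F) i j) ≤ 1 := by
    have hwN : Valued.v (-(w * N)) ≤ 1 := by rw [Valuation.map_neg, map_mul]; exact mul_le_one' hw1 hN
    have huwT : Valued.v (u + w * T) ≤ 1 := (Valuation.map_add _ _ _).trans (max_le hu1 (by rw [map_mul]; exact mul_le_one' hw1 hT))
    have h0 : Valued.v (0 : F) ≤ 1 := by rw [map_zero]; exact zero_le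
    have h1 : Valued.v (1 : F) ≤ 1 := (map_one Valued.v).le
    intro i j
    rw [hkc]
    fin_cases i <;> fin_cases j
    · exact hu1
    · exact hwN
    · exact h0
    · exact hw1
    · exact huwT
    · exact h0
    · exact h0
    · exact h0
    · exact h1
  -- `|det k| ≥ |disc π|` (anisotropy)
  have hdetk : (k : Matrix (Fin 3) (Fin 3) F).det = u ^ 2 + u * w * T + w ^ 2 * N := by rw [hkc, det_blockT]
  have hdisck : Valued.v (T ^ 2 - 4 * N) ≤ Valued.v (k : Matrix (Fin 3) (Fin 3) F).det := by
    have hQ : w * ((-u) * T - w * N) - (-u) * (-u) = -(u ^ 2 + u * w * T + w ^ 2 * N) := by ring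
    obtain ⟨h1, h2⟩ := v_discr_mul_sq_le_v_normForm hπ hT hN w (-u)
    rw [hQ, Valuation.map_neg] at h1 h2
    rw [hdetk]
    rcases hone' with h | h
    · rw [h] at h2 ⊢
      norm_num at h2 ⊢
      exact h2
    · rw [h] at h1 ⊢
      norm_num at h1 ⊢
      exact h1
  have hdet0 : (k : Matrix (Fin 3) (Fin 3) F).det ≠ 0 := (Matrix.isUnits_det_units k).ne_zero
  have hvdet0 : Valued.v (k : Matrix (Fin 3) (Fin 3) F).det ≠ 0 := (Valuation.ne_zero_iff _).2 hdet0
  -- entries of `k⁻¹ = adj(k)/det k`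
  have hkinv : ∀ i j, ((k⁻¹ : GL (Fin 3) F) : Matrix (Fin 3) (Fin 3) F) i j = ((k : Matrix (Fin 3) (Fin 3) F).det)⁻¹ * (k : Matrix (Fin 3) (Fin 3) F).adjugate i j := by
    intro i j
    rw [Matrix.coe_units_inv, Matrix.inv_def, Ring.inverse_eq_inv', Matrix.smul_apply, smul_eq_mul]
  refine ⟨a₃, k, by rw [hk, mul_inv_cancel_left], ⟨lam, z, ha₃c⟩, fun i j k' l => ?_⟩
  rw [hkinv, map_mul, map_mul, map_mul, map_inv₀]
  have hadj := v_adjugate_apply_le_one hkint k' l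
  -- `|ϖ^{L_d}| · |k_{ij}| · |det k|⁻¹ · |adj_{k'l}| ≤ |ϖ^{L_d}| |det k|⁻¹ ≤ 1`
  have h1 : Valued.v (ϖ ^ Ld) * (Valued.v (k : Matrix (Fin 3) (Fin 3) F).det)⁻¹ ≤ 1 :=
    mul_inv_le_one_of_le₀ (hdisc.trans hdisck) zero_le
  calc Valued.v (ϖ ^ Ld) * (Valued.v ((k : Matrix (Fin 3) (Fin 3) F) i j) * ((Valued.v (k : Matrix (Fin 3) (Fin 3) F).det)⁻¹ * Valued.v ((k : Matrix (Fin 3) (Fin 3) F).adjugate k' l)))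
      = (Valued.v (ϖ ^ Ld) * (Valued.v (k : Matrix (Fin 3) (Fin 3) F).det)⁻¹) *
          (Valued.v ((k : Matrix (Fin 3) (Fin 3) F) i j) * Valued.v ((k : Matrix (Fin 3) (Fin 3) F).adjugate k' l)) := by ac_rfl
    _ ≤ 1 * 1 := mul_le_mul' h1 (mul_le_one' (hkint i j) hadj)
    _ = 1 := one_mul 1

end Factor

/-! ## §3 The support of the mixed slices: `x ∈ 𝔅_{M + L_d} · A₃` -/

section Support

variable {F : Type*} [Field F] [Valued F ℤᵐ⁰] [ValuativeRel F] [(Valued.v : Valuation F ℤᵐ⁰).Compatible] [IsNonarchimedeanLocalField F]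

/-- **`x ∈ 𝔅_{M + L_d} · A₃` FROM `𝔅_M(x t)`, `tγ = γt`** (`A₃ = M_{id} ⊓ C(M_{(2,1)})` = `{diag(λ,λ,μ)}`, ★ (C) `mem_centralizer_of_coe_eq_diagonal`): `x = (x t k⁻¹) · a₃⁻¹`.
[cite: HarishChandra1970, Part VII §3 p. 71 (ii)] -/
theorem mem_adBall_mul_A₃_of_comm {ϖ : F} {x t γ : GL (Fin 3) F} {T N c : F}
    (hγ : (γ : Matrix (Fin 3) (Fin 3) F) = !![0, -N, 0; 1, T, 0; 0, 0, c])
    (hπ : ∀ r : F, r ^ 2 - T * r + N ≠ 0) (hT : Valued.v T ≤ 1) (hN : Valued.v N ≤ 1) (hπc : c ^ 2 - T * c + N ≠ 0)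
    {Ld : ℕ} (hdisc : Valued.v (ϖ ^ Ld) ≤ Valued.v (T ^ 2 - 4 * N)) (ht : t * γ = γ * t) {M : ℕ}
    (hxt : ∀ i j k l, Valued.v (ϖ ^ M * (((x * t : GL (Fin 3) F) : Matrix (Fin 3) (Fin 3) F) i j * (((x * t)⁻¹ : GL (Fin 3) F) : Matrix (Fin 3) (Fin 3) F) k l)) ≤ 1) :
    x ∈ {x : GL (Fin 3) F | ∀ i j k l, Valued.v (ϖ ^ (M + Ld) * ((x : Matrix (Fin 3) (Fin 3) F) i j * ((x⁻¹ : GL (Fin 3) F) : Matrix (Fin 3) (Fin 3) F) k l)) ≤ 1} *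
      ((standardLeviGL F (id : Fin 3 → Fin 3) ⊓ Subgroup.centralizer ((standardLeviGL F (![0, 0, 1] : Fin 3 → Fin 2) : Subgroup (GL (Fin 3) F)) : Set (GL (Fin 3) F)) :
        Subgroup (GL (Fin 3) F)) : Set (GL (Fin 3) F)) := by
  obtain ⟨a₃, k, htk, ⟨lam, z, ha₃⟩, hk⟩ := exists_blockScalar_mul_adBall_of_comm hγ hπ hT hN hπc hdisc ht
  have hk' : ∀ i j k' l, Valued.v (ϖ ^ Ld * (((k⁻¹ : GL (Fin 3) F) : Matrix (Fin 3) (Fin 3) F) i j * (((k⁻¹)⁻¹ : GL (Fin 3) F) : Matrix (Fin 3) (Fin 3) F) k' l)) ≤ 1 :=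
    adBall_inv hk
  have hB : ∀ i j k' l, Valued.v (ϖ ^ (M + Ld) * (((x * t * k⁻¹ : GL (Fin 3) F) : Matrix (Fin 3) (Fin 3) F) i j *
      (((x * t * k⁻¹)⁻¹ : GL (Fin 3) F) : Matrix (Fin 3) (Fin 3) F) k' l)) ≤ 1 := adBall_mul hxt hk'
  have hA : a₃⁻¹ ∈ (standardLeviGL F (id : Fin 3 → Fin 3) ⊓
      Subgroup.centralizer ((standardLeviGL F (![0, 0, 1] : Fin 3 → Fin 2) : Subgroup (GL (Fin 3) F)) : Set (GL (Fin 3) F)) : Subgroup (GL (Fin 3) F)) := by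
    refine Subgroup.inv_mem _ (Subgroup.mem_inf.2 ⟨mem_standardLeviGL_of_coe_eq_diagonal id ha₃, mem_centralizer_of_coe_eq_diagonal ha₃ ?_⟩)
    rfl
  refine Set.mem_mul.2 ⟨x * t * k⁻¹, hB, a₃⁻¹, hA, ?_⟩
  rw [htk]; group

/-- **THE SUPPORT INPUT OF ★ `cuspForm_cancellation_GL3_blockScalar` AT THE MIXED CARTAN** (★ T18-mixed ∘ §2): for `γ = !![0, −N, 0; 1, T, 0; 0, 0, c]` with `π = X² − TX + N`
without roots in `F`, `y = x γ x⁻¹` INTEGRAL with `ϖ^s y⁻¹` integral, depths `|ϖ^L (Nc)²| ≤ |(T² − 4N) π(c)²|` and `|ϖ^{L_d}| ≤ |T² − 4N|`: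
**`x ∈ 𝔅_{6s + L + L_d} · A₃`**, `A₃ = M_{id} ⊓ C(M_{(2,1)}) = {diag(λ,λ,μ)}` — so `m_C := 6s + L + L_d` in Theorem 20 for `Γ = T_E`.
[cite: HarishChandra1970, Part VII §2 Theorem 18 p. 69, Corollary; §3 p. 71 (ii)] -/
theorem mem_adBall_mul_A₃_of_conj_integral_mixed {ϖ : F} (hϖ : Valued.v ϖ = WithZero.exp (-1 : ℤ)) {x γ : GL (Fin 3) F} {T N c : F}
    (hγ : (γ : Matrix (Fin 3) (Fin 3) F) = !![0, -N, 0; 1, T, 0; 0, 0, c]) (hπ : ∀ r : F, r ^ 2 - T * r + N ≠ 0) (hπc : c ^ 2 - T * c + N ≠ 0)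
    (hy : ∀ i j, Valued.v ((((x * γ * x⁻¹ : GL (Fin 3) F)) : Matrix (Fin 3) (Fin 3) F) i j) ≤ 1) {s : ℕ}
    (hs : ∀ i j, Valued.v (ϖ ^ s * ((((x * γ * x⁻¹)⁻¹ : GL (Fin 3) F)) : Matrix (Fin 3) (Fin 3) F) i j) ≤ 1) {L : ℕ}
    (hD : Valued.v (ϖ ^ L * (N * c) ^ 2) ≤ Valued.v ((T ^ 2 - 4 * N) * (c ^ 2 - T * c + N) ^ 2))
    {Ld : ℕ} (hdisc : Valued.v (ϖ ^ Ld) ≤ Valued.v (T ^ 2 - 4 * N)) :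
    x ∈ {x : GL (Fin 3) F | ∀ i j k l, Valued.v (ϖ ^ (6 * s + L + Ld) * ((x : Matrix (Fin 3) (Fin 3) F) i j * ((x⁻¹ : GL (Fin 3) F) : Matrix (Fin 3) (Fin 3) F) k l)) ≤ 1} *
      ((standardLeviGL F (id : Fin 3 → Fin 3) ⊓ Subgroup.centralizer ((standardLeviGL F (![0, 0, 1] : Fin 3 → Fin 2) : Subgroup (GL (Fin 3) F)) : Set (GL (Fin 3) F)) :
        Subgroup (GL (Fin 3) F)) : Set (GL (Fin 3) F)) := by
  obtain ⟨t, ht, hxt⟩ := exists_adBall_mul_centralizer_of_conj_integral_mixed_normalised (ne_zero_of_v_eq_exp hϖ) hγ hπ hy hs hD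
  exact mem_adBall_mul_A₃_of_comm hγ hπ (v_T_le_one hγ hy) (v_N_le_one hγ hy) hπc hdisc ht hxt

end Support

end Summit.HodgeConjecture.HodgeConjecture.Cruxes.H413.K2E3GL3MixedCentralizerSupport

end
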